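import Summits.Ventures.HSemireg.WedgeHankelRecurrenceGaussHermitePhysicists

/-!
# Venture HSemireg — **THE GEGENBAUER LOWERING RELATION AND `λ`-INTERLACING**: for the monic ultraspherical recurrences `q = C^{(λ)}` (`b_{n+1} = (n+1)(n+2λ)∕(4(n+1+λ)(n+λ))`) and `P = C^{(λ+1)}`
# (`λ > 0`): the contraction identity **`(X² − 1) P_n = X q_{n+1} − ((n+2λ)∕(2(n+λ))) q_n`**, hence with the structure relation N392 **`(C^{(λ)}_{n+1})' = (n+1) · C^{(λ+1)}_n`** (Gegenbauer's
# `d∕dx C_n^λ = 2λ C_{n−1}^{λ+1}` in monic form), and the zeros `y` of `C^{(λ+1)}_t` are the critical points of `C^{(λ)}_{t+1}`, INTERLACING its zeros: `x_k < y_k < x_{k+1}`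

HONEST FRAMING. Part of the Lean index of the computation cell `pub-hsemireg` (seat p10 gen 46, Sunday typer «UNIFORM-IN-n»).  Real polynomials, derivatives and finite products only; no variety, no
cohomology theory, no sheaf, no Ext group and no semiregularity map is constructed here; nothing here says that HC / HC_CM / HC_AV holds; no Literature fact (unproved `Prop`) is declared or used.
Custodian versions as in `WedgeHankelSiegelIdeal` (1/3).
SOURCES (cited).  G. Szegő, *Orthogonal Polynomials*, (4.7.14) (`d∕dx C_n^λ = 2λ C_{n−1}^{λ+1}`), (4.7.27)–(4.7.29) (structure ∕ contraction relations), §6.21; M. Abramowitz, I. Stegun, *Handbook*,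
22.8.x, 22.7.x; T. S. Chihara, *An Introduction to Orthogonal Polynomials* (1978), Ch. V §2.
PROOF TYPED HERE.  The contraction identity by the pair induction `C_n, C_{n+1} ⇒ C_{n+2}` from the two recurrences, with the scalar identities `γ_{n+2} + b_{n+2} = γ_{n+1} + b'_{n+1}` and
`b'_{n+1} γ_n = γ_{n+2} b_{n+1}` (`γ_n = (n+2λ)∕(2(n+λ))`, `field_simp; ring`); lowering: `(X²−1) q_{n+1}' = (n+1) X q_{n+1} − β_{n+1} q_n` (N392) `= (n+1)(X²−1) P_n` since `β_{n+1} = (n+1)γ_n`,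
cancel `X² − 1`; interlacing as in N391 (N365 `derivative_zero_mem_gap`, N294 `strictMono_eq_of_prod_X_sub_C_eq`).
DEDUP DISCLOSURE (`rg -n -i 'gegenbauer_lowering|gegenbauer_contraction|gegenbauer_derivative' Summits/Ventures/HSemireg`, 2026-09-03): N392 (structure relation, equation), N391 (Laguerre analogue);
nothing for the `λ → λ+1` lowering.  The 3 names below: 0 hits tree-wide.

WHAT IS IN THE TREE.  N392 `gegenbauer_structure_relation`; N365 `derivative_zero_mem_gap`; N294 `strictMono_eq_of_prod_X_sub_C_eq`; N279 `recurrence_zeros_interlace`, `recurrence_monic_natDegree`,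
`eq_prod_X_sub_C_of_monic_of_roots`; Mathlib `X_pow_sub_C_ne_zero`.
THIS FILE (namespace `Summit.Ventures.HSemireg.Wedge.HankelOuter` continued; CHAINED on N395 (import only); 0 definitions):
* §1161 **`gegenbauer_contraction`**, **`gegenbauer_derivative_lowering`**, **`gegenbauer_lowering_interlace`**.
CAVEATS.  `λ > 0`, monic normalisation, recurrence-only.  Nothing Ext-side.  New names only.
-/

open Module Polynomial
open scoped Matrix Polynomial

namespace Summit.Ventures.HSemireg.Wedge.HankelOuter

/-! ## §1161. Gegenbauer: lowering the degree, raising `λ` -/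

/-- **The contraction identity `(X² − 1) P_n = X q_{n+1} − ((n+2λ)∕(2(n+λ))) q_n`** for `q = C^{(λ)}`, `P = C^{(λ+1)}` (monic recurrences, `λ > 0`). [Szegő (4.7.27)–(4.7.29); this file, §1161] -/
theorem gegenbauer_contraction {q P : ℕ → ℝ[X]} {a b a' b' : ℕ → ℝ} {lam : ℝ} (hq0 : q 0 = 1) (hq1 : q 1 = Polynomial.X - C (a 0))
    (hrec : ∀ n, q (n + 2) = (Polynomial.X - C (a (n + 1))) * q (n + 1) - C (b (n + 1)) * q n) (ha : ∀ n, a n = 0)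
    (hb : ∀ n, b (n + 1) = ((n : ℝ) + 1) * ((n : ℝ) + 2 * lam) / (4 * ((n : ℝ) + 1 + lam) * ((n : ℝ) + lam)))
    (hP0 : P 0 = 1) (hP1 : P 1 = Polynomial.X - C (a' 0)) (hPrec : ∀ n, P (n + 2) = (Polynomial.X - C (a' (n + 1))) * P (n + 1) - C (b' (n + 1)) * P n) (ha' : ∀ n, a' n = 0)
    (hb' : ∀ n, b' (n + 1) = ((n : ℝ) + 1) * ((n : ℝ) + 2 * (lam + 1)) / (4 * ((n : ℝ) + 1 + (lam + 1)) * ((n : ℝ) + (lam + 1)))) (hlam : 0 < lam) (n : ℕ) :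
    (Polynomial.X ^ 2 - 1) * P n = Polynomial.X * q (n + 1) - C (((n : ℝ) + 2 * lam) / (2 * ((n : ℝ) + lam))) * q n := by
  obtain ⟨γ, hγ⟩ : ∃ γ : ℕ → ℝ, γ = fun (m : ℕ) => ((m : ℝ) + 2 * lam) / (2 * ((m : ℝ) + lam)) := ⟨_, rfl⟩
  have hγv : ∀ m : ℕ, γ m = ((m : ℝ) + 2 * lam) / (2 * ((m : ℝ) + lam)) := fun m => by rw [hγ]
  have hq1' : q 1 = Polynomial.X := by rw [hq1, ha, C_0, sub_zero]
  have hP1' : P 1 = Polynomial.X := by rw [hP1, ha', C_0, sub_zero]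
  have hrec' : ∀ m, q (m + 2) = Polynomial.X * q (m + 1) - C (b (m + 1)) * q m := fun m => by rw [hrec m, ha, C_0, sub_zero]
  have hPrec' : ∀ m, P (m + 2) = Polynomial.X * P (m + 1) - C (b' (m + 1)) * P m := fun m => by rw [hPrec m, ha', C_0, sub_zero]
  -- the two scalar identities
  have hI : ∀ m : ℕ, γ (m + 2) + b (m + 2) - γ (m + 1) - b' (m + 1) = 0 := fun m => by
    have h0 : (0 : ℝ) ≤ m := Nat.cast_nonneg m
    rw [hγv, hγv, show m + 2 = (m + 1) + 1 from rfl, hb, hb']; push_cast; field_simp; ring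
  have hII : ∀ m : ℕ, b' (m + 1) * γ m - γ (m + 2) * b (m + 1) = 0 := fun m => by
    have h0 : (0 : ℝ) ≤ m := Nat.cast_nonneg m
    rw [hγv, hγv, hb, hb']; push_cast; field_simp; ring
  have key : ∀ n, (Polynomial.X ^ 2 - 1) * P n = Polynomial.X * q (n + 1) - C (γ n) * q n ∧
      (Polynomial.X ^ 2 - 1) * P (n + 1) = Polynomial.X * q (n + 2) - C (γ (n + 1)) * q (n + 1) := by
    intro n
    induction n with
    | zero =>
      have hγ0 : γ 0 = 1 := by rw [hγv]; push_cast; field_simp; ring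
      have hγ1 : γ 1 + b 1 = 1 := by
        have hb1 := hb 0
        rw [zero_add] at hb1
        rw [hγv, hb1]; push_cast; field_simp; ring
      have hq2 : q 2 = Polynomial.X * Polynomial.X - C (b 1) * 1 := by have h := hrec' 0; rw [zero_add, zero_add, hq1', hq0] at h; exact h
      constructor
      · rw [hP0, zero_add, hq1', hq0, hγ0, map_one]; ring
      · rw [zero_add, hP1', hq2, hq1']
        have hc : C (γ 1) = 1 - C (b 1) := by rw [show γ 1 = 1 - b 1 by linarith, map_sub, map_one]
        rw [hc]; ring
    | succ n ih =>
      obtain ⟨c0, c1⟩ := ih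
      refine ⟨by rw [show n + 1 + 1 = n + 2 from rfl]; exact c1, ?_⟩
      rw [show n + 1 + 1 = n + 2 from rfl, show n + 1 + 2 = n + 3 from rfl, hPrec' n, show n + 3 = (n + 1) + 2 from rfl, hrec' (n + 1), show n + 1 + 1 = n + 2 from rfl]
      have h2 := hrec' n
      have hIC : C (γ (n + 2)) + C (b (n + 2)) - C (γ (n + 1)) - C (b' (n + 1)) = 0 := by
        have := congrArg C (hI n); simpa only [map_add, map_sub, map_zero] using this
      have hIIC : C (b' (n + 1)) * C (γ n) - C (γ (n + 2)) * C (b (n + 1)) = 0 := by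
        have := congrArg C (hII n); simpa only [map_mul, map_sub, map_zero] using this
      linear_combination Polynomial.X * c1 - C (b' (n + 1)) * c0 + (Polynomial.X * q (n + 1)) * hIC + (q n) * hIIC + C (γ (n + 2)) * h2
  rw [← hγv]; exact (key n).1

/-- **GEGENBAUER'S LOWERING RELATION: `(C^{(λ)}_{n+1})' = (n + 1) · C^{(λ+1)}_n`** (monic). [Szegő (4.7.14); this file, §1161] -/
theorem gegenbauer_derivative_lowering {q P : ℕ → ℝ[X]} {a b a' b' : ℕ → ℝ} {lam : ℝ} (hq0 : q 0 = 1) (hq1 : q 1 = Polynomial.X - C (a 0))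
    (hrec : ∀ n, q (n + 2) = (Polynomial.X - C (a (n + 1))) * q (n + 1) - C (b (n + 1)) * q n) (ha : ∀ n, a n = 0)
    (hb : ∀ n, b (n + 1) = ((n : ℝ) + 1) * ((n : ℝ) + 2 * lam) / (4 * ((n : ℝ) + 1 + lam) * ((n : ℝ) + lam)))
    (hP0 : P 0 = 1) (hP1 : P 1 = Polynomial.X - C (a' 0)) (hPrec : ∀ n, P (n + 2) = (Polynomial.X - C (a' (n + 1))) * P (n + 1) - C (b' (n + 1)) * P n) (ha' : ∀ n, a' n = 0)
    (hb' : ∀ n, b' (n + 1) = ((n : ℝ) + 1) * ((n : ℝ) + 2 * (lam + 1)) / (4 * ((n : ℝ) + 1 + (lam + 1)) * ((n : ℝ) + (lam + 1)))) (hlam : 0 < lam) (n : ℕ) :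
    derivative (q (n + 1)) = C ((n : ℝ) + 1) * P n := by
  have hS : (Polynomial.X ^ 2 - 1 : ℝ[X]) ≠ 0 := by rw [← C_1]; exact X_pow_sub_C_ne_zero two_pos 1
  have hs := gegenbauer_structure_relation hq0 hq1 hrec ha hb hlam n
  have hc := gegenbauer_contraction hq0 hq1 hrec ha hb hP0 hP1 hPrec ha' hb' hlam n
  have h0 : (0 : ℝ) ≤ n := Nat.cast_nonneg n
  have hβ : C (((n : ℝ) + 1) * ((n : ℝ) + 2 * lam) / (2 * ((n : ℝ) + lam))) = C ((n : ℝ) + 1) * C (((n : ℝ) + 2 * lam) / (2 * ((n : ℝ) + lam))) := by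
    rw [← map_mul]; congr 1; field_simp
  apply mul_left_cancel₀ hS
  rw [hs, hβ, mul_left_comm, hc]
  ring

/-- **THE ZEROS OF `C^{(λ+1)}_t` INTERLACE THOSE OF `C^{(λ)}_{t+1}`** (`λ > 0`): they are its critical points — `x_k < y_k < x_{k+1}`. [Szegő §6.21; this file, §1161] -/
theorem gegenbauer_lowering_interlace {q P : ℕ → ℝ[X]} {a b a' b' : ℕ → ℝ} {lam : ℝ} (hq0 : q 0 = 1) (hq1 : q 1 = Polynomial.X - C (a 0))
    (hrec : ∀ n, q (n + 2) = (Polynomial.X - C (a (n + 1))) * q (n + 1) - C (b (n + 1)) * q n) (ha : ∀ n, a n = 0)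
    (hb : ∀ n, b (n + 1) = ((n : ℝ) + 1) * ((n : ℝ) + 2 * lam) / (4 * ((n : ℝ) + 1 + lam) * ((n : ℝ) + lam)))
    (hP0 : P 0 = 1) (hP1 : P 1 = Polynomial.X - C (a' 0)) (hPrec : ∀ n, P (n + 2) = (Polynomial.X - C (a' (n + 1))) * P (n + 1) - C (b' (n + 1)) * P n) (ha' : ∀ n, a' n = 0)
    (hb' : ∀ n, b' (n + 1) = ((n : ℝ) + 1) * ((n : ℝ) + 2 * (lam + 1)) / (4 * ((n : ℝ) + 1 + (lam + 1)) * ((n : ℝ) + (lam + 1)))) (hlam : 0 < lam) (hb0 : 0 < b 0)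
    {t : ℕ} {x : Fin (t + 2) → ℝ} {y : Fin (t + 1) → ℝ} (hx : StrictMono x) (hxq : q (t + 2) = ∏ k, (Polynomial.X - C (x k))) (hy : StrictMono y)
    (hyq : P (t + 1) = ∏ k, (Polynomial.X - C (y k))) (k : Fin (t + 1)) : x k.castSucc < y k ∧ y k < x k.succ := by
  classical
  have hbpos : ∀ j, 0 < b j := fun j => by
    rcases j with _ | n
    · exact hb0
    · rw [hb]; have h0 : (0 : ℝ) ≤ n := Nat.cast_nonneg n; positivity
  have hgap : ∀ j : Fin (t + 1), ∃ η, x j.castSucc < η ∧ η < x j.succ ∧ (derivative (q (t + 2))).eval η = 0 := fun j => by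
    have hjt : ((j.castSucc : Fin (t + 2)) : ℕ) + 1 ≤ t + 1 := by rw [Fin.val_castSucc]; have := j.isLt; omega
    obtain ⟨η, h1, h2, h3⟩ := derivative_zero_mem_gap hq0 hq1 hrec hbpos hx hxq j.castSucc hjt
    refine ⟨η, h1, ?_, h3⟩
    have : (⟨(j.castSucc : ℕ) + 1, by omega⟩ : Fin (t + 2)) = j.succ := Fin.ext (by simp)
    rw [this] at h2; exact h2
  choose η hη using hgap
  have hηmono : StrictMono η := fun i j hij => by
    have h1 := (hη i).2.1
    have h2 := (hη j).1
    have hij' : (i : ℕ) < j := Fin.lt_def.1 hij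
    have h3 : x i.succ ≤ x j.castSucc := hx.monotone (by rw [Fin.le_def, Fin.val_succ, Fin.val_castSucc]; omega)
    linarith
  have hlow := gegenbauer_derivative_lowering hq0 hq1 hrec ha hb hP0 hP1 hPrec ha' hb' hlam (t + 1)
  have hroot : ∀ j, (P (t + 1)).eval (η j) = 0 := fun j => by
    have h := congrArg (eval (η j)) hlow
    rw [(hη j).2.2, eval_mul, eval_C] at h
    have hne : ((((t + 1 : ℕ) : ℝ)) + 1) ≠ 0 := by positivity
    exact (mul_eq_zero.1 h.symm).resolve_left (by push_cast at hne ⊢; exact hne)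
  obtain ⟨hPm, hPd⟩ := recurrence_monic_natDegree hP0 hP1 hPrec (t + 1)
  have hPη : P (t + 1) = ∏ j, (Polynomial.X - C (η j)) := eq_prod_X_sub_C_of_monic_of_roots hPm hPd hηmono.injective hroot
  have hyη : y = η := strictMono_eq_of_prod_X_sub_C_eq hy hηmono (hyq.symm.trans hPη)
  subst hyη
  exact ⟨(hη k).1, (hη k).2.1⟩

end Summit.Ventures.HSemireg.Wedge.HankelOuter
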